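import Mathlib
import Summits.ValiantsHypothesis.ValiantsHypothesis.Theorems.NewtonUnitEquationsDissociatedUniformTotalsLawChains
import HarnessLib

/-!
# Crux `NewtonUnitEquations.DissociatedUniform` (stmt-ValiantsHypothesis-5905): the LAP COUNT — chain points of co-monotone mode lifts number `O(q)`

Companion of `…TotalsLawChains` (chain localisation) and `…TotalsLawChainCount` (dense-positions regime).  The uniform pointwise rung on
the convexly ordered stratum (`ConvexUnionVertBound C`, `C ∈ [3, 4]` by the census of memo `Cruxes/DissociatedUniform/NOTES-t1g6.md`)
rests on a KINETIC fact (memo §3 (K1)): along a chart the two modes of a co-oriented pair advance monotonically, the forward chains of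
successive mode pairs inside one gap are NESTED, and a gap is visited at most three times per chart ("laps").  This file proves the
purely combinatorial heart of that count, with time abstracted to any linear order:

* `gapBelow W r` (least `n ≥ 1` with `r - n ∈ W`) and **`sum_gapBelow_eq`**: `∑_{r ∈ W} gapBelow W r = q` (the backward gaps of a
  nonempty position set tile `ℤ/q`);
* **`card_forwardChainPoints_le`**: if `P, Q : T → ℕ` are MONOTONE ("lifts" of the two modes along a chart: modes `x₀ + P t`,
  `y₀ + Q t`) with `P, Q < q`, then the set of all forward-chain points `(x₀ + P t + i, y₀ + Q t + j)` (fibre `m_t + i + j` present, fibres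
  `m_t + n`, `n < i + j`, absent) over ALL times has at most `3q` elements — group the points by the lifted index `K = P t + Q t + i + j < 3q`
  (which fixes the fibre and the lap); inside a group all points lie in the chain window of the EARLIEST witness time, of size
  `≤ gapBelow` of the fibre; sum with `sum_gapBelow_eq` over three laps.  The backward chains are the same statement for the reversed
  label order / reversed time.
What is NOT here: the existence of monotone lifts for (locally strict, co-oriented) convexly ordered curves (memo §3 (K3); toolkit in
`…TotalsLawModes`) and the assembly with chain localisation over the two charts.
Honest label: a combinatorial lemma; `ConvexUnionVertBound C` (`C ≥ 3`), `UnionTotalsLaw`, `TotalsLawThree` remain OPEN; nothing here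
bears on VP ≠ VNP.
[folklore]
-/

set_option linter.dupNamespace false -- `ValiantsHypothesis.ValiantsHypothesis` (summit = problem) in every name

open scoped BigOperators

namespace Summit.ValiantsHypothesis.ValiantsHypothesis.Theorems.NewtonUnitEquationsDissociatedUniform

namespace TotalsLaw

section Laps

variable {q : ℕ} [NeZero q]

/-- Every position is reached from itself in `q ≥ 1` backward steps: the defining existence for `gapBelow`. [folklore] -/
theorem exists_gapBelow (W : Finset (ZMod q)) {r : ZMod q} (hr : r ∈ W) : ∃ n : ℕ, 1 ≤ n ∧ r - (n : ZMod q) ∈ W :=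
  ⟨q, Nat.one_le_iff_ne_zero.2 (NeZero.ne q), by rw [ZMod.natCast_self, sub_zero]; exact hr⟩

open Classical in
/-- The BACKWARD GAP of `r` in `W`: the least `n ≥ 1` with `r - n ∈ W` (for `r ∈ W`; junk value `0` off `W`). -/
noncomputable def gapBelow (W : Finset (ZMod q)) (r : ZMod q) : ℕ :=
  if hr : r ∈ W then Nat.find (exists_gapBelow W hr) else 0

/-- Specification of the backward gap: `1 ≤ G`, `r - G ∈ W`, and `r - n ∉ W` for `0 < n < G`. [folklore] -/
theorem gapBelow_spec (W : Finset (ZMod q)) {r : ZMod q} (hr : r ∈ W) :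
    1 ≤ gapBelow W r ∧ r - (gapBelow W r : ZMod q) ∈ W ∧ ∀ n : ℕ, 1 ≤ n → n < gapBelow W r → r - (n : ZMod q) ∉ W := by
  classical
  unfold gapBelow
  rw [dif_pos hr]
  refine ⟨(Nat.find_spec (exists_gapBelow W hr)).1, (Nat.find_spec (exists_gapBelow W hr)).2, fun n hn hlt hmem => ?_⟩
  exact Nat.find_min (exists_gapBelow W hr) hlt ⟨hn, hmem⟩

/-- The backward gap is at most `q`. [folklore] -/
theorem gapBelow_le (W : Finset (ZMod q)) (r : ZMod q) : gapBelow W r ≤ q := by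
  classical
  unfold gapBelow
  split_ifs with hr
  · exact Nat.find_le ⟨Nat.one_le_iff_ne_zero.2 (NeZero.ne q), by rw [ZMod.natCast_self, sub_zero]; exact hr⟩
  · exact Nat.zero_le _

/-- The forward distance from a position to the set `W`: least `n` with `z + n ∈ W`. [folklore] -/
theorem exists_fwd (W : Finset (ZMod q)) (hW : W.Nonempty) (z : ZMod q) : ∃ n : ℕ, z + (n : ZMod q) ∈ W := by
  obtain ⟨r, hr⟩ := hW
  obtain ⟨n, -, hn⟩ := exists_nat_shift z r
  exact ⟨n, hn ▸ hr⟩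

/-- **The backward gaps tile `ℤ/q`**: `∑_{r ∈ W} gapBelow W r = q` for every nonempty position set. [folklore] -/
theorem sum_gapBelow_eq (W : Finset (ZMod q)) (hW : W.Nonempty) : ∑ r ∈ W, gapBelow W r = q := by
  classical
  -- `f z` = the first element of `W` at or after `z`
  let d : ZMod q → ℕ := fun z => Nat.find (exists_fwd W hW z)
  let f : ZMod q → ZMod q := fun z => z + (d z : ZMod q)
  have hfW : ∀ z, f z ∈ W := fun z => Nat.find_spec (exists_fwd W hW z)
  have hdmin : ∀ z (n : ℕ), n < d z → z + (n : ZMod q) ∉ W := fun z n hn => Nat.find_min (exists_fwd W hW z) hn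
  -- the fibre of `f` over `r ∈ W` is `{r - n : n < gapBelow W r}`
  have hfibre : ∀ r ∈ W, (Finset.univ.filter fun z => f z = r).card = gapBelow W r := by
    intro r hr
    obtain ⟨hG1, hGmem, hGmin⟩ := gapBelow_spec W hr
    have hGq : gapBelow W r ≤ q := gapBelow_le W r
    -- the fibre is the image of `n ↦ r - n`, `n < G`
    have heq : (Finset.univ.filter fun z => f z = r) = (Finset.range (gapBelow W r)).image fun n : ℕ => r - (n : ZMod q) := by
      ext z
      simp only [Finset.mem_filter, Finset.mem_univ, true_and, Finset.mem_image, Finset.mem_range]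
      constructor
      · intro hz
        -- `d z < G`, and `z = r - d z`
        have hzr : z = r - (d z : ZMod q) := by rw [← hz]; simp [f]
        refine ⟨d z, ?_, hzr.symm⟩
        by_contra hge
        push Not at hge
        -- then `z + (d z - G) = r - G ∈ W` with a smaller shift
        have hlt : d z - gapBelow W r < d z := by omega
        apply hdmin z (d z - gapBelow W r) hlt
        have hz' : z + (d z : ZMod q) = r := hz
        have : z + ((d z - gapBelow W r : ℕ) : ZMod q) = r - (gapBelow W r : ZMod q) := by
          rw [Nat.cast_sub hge, ← hz']; ring
        rw [this]; exact hGmem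
      · rintro ⟨n, hn, rfl⟩
        -- `d (r - n) = n`
        have hdn : d (r - (n : ZMod q)) = n := by
          apply le_antisymm
          · exact Nat.find_le (by rw [sub_add_cancel]; exact hr)
          · by_contra hlt
            push Not at hlt
            have hmem := Nat.find_spec (exists_fwd W hW (r - (n : ZMod q)))
            have hpos : 1 ≤ n - d (r - (n : ZMod q)) := by omega
            have hlt' : n - d (r - (n : ZMod q)) < gapBelow W r := by omega
            apply hGmin _ hpos hlt'
            have : r - ((n - d (r - (n : ZMod q)) : ℕ) : ZMod q) = r - (n : ZMod q) + (d (r - (n : ZMod q)) : ZMod q) := by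
              rw [Nat.cast_sub hlt.le]; ring
            rw [this]; exact hmem
        show r - (n : ZMod q) + (d (r - (n : ZMod q)) : ZMod q) = r
        rw [hdn, sub_add_cancel]
    rw [heq, Finset.card_image_of_injOn, Finset.card_range]
    intro n hn n' hn' h
    have hnq : n < q := lt_of_lt_of_le (Finset.mem_range.1 hn) hGq
    have hn'q : n' < q := lt_of_lt_of_le (Finset.mem_range.1 hn') hGq
    have h' : ((n : ℕ) : ZMod q) = (n' : ZMod q) := by
      have := congrArg (fun z => r - z) h
      simpa using this
    have := (ZMod.natCast_eq_natCast_iff' n n' q).1 h'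
    rwa [Nat.mod_eq_of_lt hnq, Nat.mod_eq_of_lt hn'q] at this
  -- count `ℤ/q` by the fibres of `f`
  have htot := Finset.card_eq_sum_card_fiberwise (f := f) (s := (Finset.univ : Finset (ZMod q))) (t := W) fun z _ => hfW z
  rw [Finset.card_univ, ZMod.card] at htot
  have hsum : ∑ r ∈ W, gapBelow W r = ∑ r ∈ W, (Finset.univ.filter fun z => f z = r).card :=
    Finset.sum_congr rfl fun r hr => (hfibre r hr).symm
  omega

/-- **The lap count.**  Let `P, Q : T → ℕ` be monotone along a linear order of "times" with `P, Q < q` (lifts of the two modes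
`x₀ + P t`, `y₀ + Q t` of a co-oriented pair along a chart).  A FORWARD-CHAIN POINT is a pair `(x₀ + P t + i, y₀ + Q t + j)` whose fibre
`m_t + i + j` (`m_t = x₀ + y₀ + P t + Q t`) is present while the fibres `m_t + n`, `n < i + j`, are absent.  Any finite set of
forward-chain points has at most `3q` elements. [folklore] -/
theorem card_forwardChainPoints_le {T : Type*} [LinearOrder T] [Nonempty T] (W : Finset (ZMod q)) (x₀ y₀ : ZMod q) (P Q : T → ℕ)
    (hP : Monotone P) (hQ : Monotone Q) (hPq : ∀ t, P t < q) (hQq : ∀ t, Q t < q) (C : Finset (ZMod q × ZMod q))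
    (hC : ∀ xy ∈ C, ∃ (t : T) (i j : ℕ), xy = (x₀ + (P t : ZMod q) + (i : ZMod q), y₀ + (Q t : ZMod q) + (j : ZMod q)) ∧
      x₀ + y₀ + (P t : ZMod q) + (Q t : ZMod q) + ((i + j : ℕ) : ZMod q) ∈ W ∧
      ∀ n : ℕ, n < i + j → x₀ + y₀ + (P t : ZMod q) + (Q t : ZMod q) + (n : ZMod q) ∉ W) :
    C.card ≤ 3 * q := by
  classical
  by_cases hCempty : C = ∅
  · rw [hCempty, Finset.card_empty]; exact Nat.zero_le _
  have hW : W.Nonempty := by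
    obtain ⟨xy, hxy⟩ := Finset.nonempty_iff_ne_empty.2 hCempty
    obtain ⟨t, i, j, -, hmem, -⟩ := hC xy hxy
    exact ⟨_, hmem⟩
  -- chosen witnesses
  choose! wt wi wj hwit using hC
  -- the lifted index `K = P t + Q t + i + j` of a point
  let K : ZMod q × ZMod q → ℕ := fun xy => P (wt xy) + Q (wt xy) + (wi xy + wj xy)
  -- gap bound: `i + j < gapBelow W (fibre)`, hence `K < 3q`
  have hgap : ∀ xy ∈ C, wi xy + wj xy < gapBelow W (x₀ + y₀ + (P (wt xy) : ZMod q) + (Q (wt xy) : ZMod q) +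
      ((wi xy + wj xy : ℕ) : ZMod q)) := by
    intro xy hxy
    obtain ⟨-, hmem, hmin⟩ := hwit xy hxy
    obtain ⟨-, hGmem, -⟩ := gapBelow_spec W hmem
    set G := gapBelow W (x₀ + y₀ + (P (wt xy) : ZMod q) + (Q (wt xy) : ZMod q) + ((wi xy + wj xy : ℕ) : ZMod q))
    by_contra hge
    push Not at hge
    apply hmin (wi xy + wj xy - G) (by have := (gapBelow_spec W hmem).1; omega)
    have : x₀ + y₀ + (P (wt xy) : ZMod q) + (Q (wt xy) : ZMod q) + ((wi xy + wj xy - G : ℕ) : ZMod q) =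
        x₀ + y₀ + (P (wt xy) : ZMod q) + (Q (wt xy) : ZMod q) + ((wi xy + wj xy : ℕ) : ZMod q) - (G : ZMod q) := by
      rw [Nat.cast_sub hge]; ring
    rw [this]; exact hGmem
  have hK : ∀ xy ∈ C, K xy < 3 * q := by
    intro xy hxy
    have h1 := hPq (wt xy); have h2 := hQq (wt xy)
    have h3 := (hgap xy hxy).trans_le (gapBelow_le W _)
    simp only [K]; omega
  -- group by `K`: each group lies in the chain window of its earliest witness
  have hgroup : ∀ k : ℕ, (C.filter fun xy => K xy = k).card ≤ gapBelow W (x₀ + y₀ + (k : ZMod q)) := by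
    intro k
    set Ck := C.filter fun xy => K xy = k with hCk
    by_cases hk : Ck = ∅
    · rw [hk, Finset.card_empty]; exact Nat.zero_le _
    obtain ⟨e, heCk, hemin⟩ := Finset.exists_min_image Ck wt (Finset.nonempty_iff_ne_empty.2 hk)
    have heC : e ∈ C := (Finset.mem_filter.1 heCk).1
    have heK : K e = k := (Finset.mem_filter.1 heCk).2
    set t₀ := wt e with ht₀
    set g₀ := wi e + wj e with hg₀
    -- fibre of the group is `x₀ + y₀ + k`
    have hfib : x₀ + y₀ + (P t₀ : ZMod q) + (Q t₀ : ZMod q) + ((wi e + wj e : ℕ) : ZMod q) = x₀ + y₀ + (k : ZMod q) := by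
      rw [← heK]; simp only [K]; push_cast; ring
    have hg₀G : g₀ < gapBelow W (x₀ + y₀ + (k : ZMod q)) := by
      have := hgap e heC; rwa [hfib] at this
    -- every element of the group is `(x₀ + P t₀ + c, _)` with `c ≤ g₀`
    -- components of the witnessed representation and the fibre of a group element
    have hcomp : ∀ xy ∈ Ck, xy.1 = x₀ + (P (wt xy) : ZMod q) + (wi xy : ZMod q) ∧
        xy.1 + xy.2 = x₀ + y₀ + (k : ZMod q) := by
      intro xy hxy
      have hxyC : xy ∈ C := (Finset.mem_filter.1 hxy).1
      have hxyK : P (wt xy) + Q (wt xy) + (wi xy + wj xy) = k := (Finset.mem_filter.1 hxy).2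
      obtain ⟨hxyeq, -, -⟩ := hwit xy hxyC
      have hx1 : xy.1 = x₀ + (P (wt xy) : ZMod q) + (wi xy : ZMod q) := by
        have := congrArg Prod.fst hxyeq; simpa using this
      have hx2 : xy.2 = y₀ + (Q (wt xy) : ZMod q) + (wj xy : ZMod q) := by
        have := congrArg Prod.snd hxyeq; simpa using this
      refine ⟨hx1, ?_⟩
      have hKc : ((P (wt xy) + Q (wt xy) + (wi xy + wj xy) : ℕ) : ZMod q) = (k : ZMod q) := by rw [hxyK]
      rw [hx1, hx2, ← hKc]; push_cast; ring
    have hwindow : ∀ xy ∈ Ck, ∃ c : ℕ, c ≤ g₀ ∧ xy.1 = x₀ + (P t₀ : ZMod q) + (c : ZMod q) := by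
      intro xy hxy
      have hxyK : P (wt xy) + Q (wt xy) + (wi xy + wj xy) = k := (Finset.mem_filter.1 hxy).2
      have heK' : P t₀ + Q t₀ + g₀ = k := heK
      have hle : wt e ≤ wt xy := hemin xy hxy
      have hPle : P t₀ ≤ P (wt xy) := hP hle
      have hQle : Q t₀ ≤ Q (wt xy) := hQ hle
      refine ⟨P (wt xy) - P t₀ + wi xy, by omega, ?_⟩
      rw [(hcomp xy hxy).1, Nat.cast_add, Nat.cast_sub hPle]; ring
    -- inject the group into `range (g₀ + 1)` by the offset `c`
    have hinj : Set.InjOn (fun xy : ZMod q × ZMod q => xy.1) Ck := by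
      intro xy hxy xy' hxy' h1
      simp only at h1
      have hs := (hcomp xy hxy).2
      have hs' := (hcomp xy' hxy').2
      have h2 : xy.2 = xy'.2 := by
        have := hs.trans hs'.symm
        rw [h1] at this
        exact add_left_cancel this
      exact Prod.ext h1 h2
    calc Ck.card = (Ck.image fun xy : ZMod q × ZMod q => xy.1).card := (Finset.card_image_of_injOn hinj).symm
      _ ≤ ((Finset.range (g₀ + 1)).image fun c : ℕ => x₀ + (P t₀ : ZMod q) + (c : ZMod q)).card := by
          apply Finset.card_le_card
          intro x hx
          obtain ⟨xy, hxy, rfl⟩ := Finset.mem_image.1 hx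
          obtain ⟨c, hc, hceq⟩ := hwindow xy hxy
          exact Finset.mem_image.2 ⟨c, Finset.mem_range.2 (by omega), hceq.symm⟩
      _ ≤ (Finset.range (g₀ + 1)).card := Finset.card_image_le
      _ = g₀ + 1 := Finset.card_range _
      _ ≤ gapBelow W (x₀ + y₀ + (k : ZMod q)) := hg₀G
  -- sum over the index `K < 3q`, three laps of `q`
  have hcover : C.card = ∑ k ∈ Finset.range (3 * q), (C.filter fun xy => K xy = k).card :=
    Finset.card_eq_sum_card_fiberwise fun xy hxy => Finset.mem_range.2 (hK xy hxy)
  rw [hcover]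
  calc ∑ k ∈ Finset.range (3 * q), (C.filter fun xy => K xy = k).card
      ≤ ∑ k ∈ Finset.range (3 * q), gapBelow W (x₀ + y₀ + (k : ZMod q)) := Finset.sum_le_sum fun k _ => hgroup k
    _ = 3 * ∑ r ∈ W, gapBelow W r := by
        -- `k ↦ x₀ + y₀ + k` runs three times over `ℤ/q`; off `W` the gap is `0`
        have hper : ∀ ℓ : ℕ, ∑ k ∈ Finset.range q, gapBelow W (x₀ + y₀ + ((ℓ * q + k : ℕ) : ZMod q)) =
            ∑ r ∈ W, gapBelow W r := by
          intro ℓ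
          have hφ : Function.Bijective (fun k : Fin q => ((k : ℕ) : ZMod q)) := by
            rw [Fintype.bijective_iff_injective_and_card]
            refine ⟨fun k k' h => Fin.ext ?_, by simp [ZMod.card]⟩
            have := (ZMod.natCast_eq_natCast_iff' k k' q).1 h
            rwa [Nat.mod_eq_of_lt k.2, Nat.mod_eq_of_lt k'.2] at this
          have h1 : ∑ k ∈ Finset.range q, gapBelow W (x₀ + y₀ + ((ℓ * q + k : ℕ) : ZMod q)) =
              ∑ z : ZMod q, gapBelow W (x₀ + y₀ + z) := by
            rw [← Fin.sum_univ_eq_sum_range (fun k => gapBelow W (x₀ + y₀ + ((ℓ * q + k : ℕ) : ZMod q)))]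
            refine Fintype.sum_bijective _ hφ _ _ fun k => ?_
            congr 2
            push_cast
            rw [ZMod.natCast_self, mul_zero, zero_add]
          have h2 : ∑ z : ZMod q, gapBelow W (x₀ + y₀ + z) = ∑ z : ZMod q, gapBelow W z := by
            have := Equiv.sum_comp (Equiv.addLeft (x₀ + y₀)) (fun z => gapBelow W z)
            simpa only [Equiv.coe_addLeft] using this
          rw [h1, h2, ← Finset.sum_filter_add_sum_filter_not Finset.univ (fun z => z ∈ W)]
          have hz : ∑ z ∈ Finset.univ.filter (fun z => ¬ z ∈ W), gapBelow W z = 0 :=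
            Finset.sum_eq_zero fun z hz => by
              unfold gapBelow; rw [dif_neg (Finset.mem_filter.1 hz).2]
          rw [hz, add_zero]
          congr 1
          ext z; simp
        rw [show 3 * q = q + q + q by ring, Finset.sum_range_add, Finset.sum_range_add]
        have e0 := hper 0
        have e1 := hper 1
        have e2 := hper 2
        simp only [zero_mul, zero_add, one_mul] at e0 e1 e2
        rw [show q + q = 2 * q by ring] 
        rw [e0, e1, e2]; ring
    _ = 3 * q := by rw [sum_gapBelow_eq W hW]

end Laps

end TotalsLaw

end Summit.ValiantsHypothesis.ValiantsHypothesis.Theorems.NewtonUnitEquationsDissociatedUniform
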